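import Literature.Combinatorics.Sahi2008.ProvedCases
import Mathlib.Order.ModularLattice
import HarnessLib

/-!
# `NoHeavyLowerTail` (crux stmt-CriticalPhenomena-4575), route P3 (Ahlswede–Daykin): Sahi's `C₃` FAILS on the diamond `M₃` —
# the distributivity hypothesis of `SahiConjecture 3` cannot be weakened to "modular lattice", and the located gap of the AD route

Support file (cell `prim-l12`, seat P3; `--supports stmt-CriticalPhenomena-4575`).  Companion of `…ThreePartitionAD(Twisted)`.

On the five-element diamond `M₃ = {⊥, a, b, c, ⊤}` (the smallest modular non-distributive lattice) take the probability weight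
`μ = (1/4; 1/6, 1/6, 1/6; 1/4)` and the three up-sets `U = {a, b, ⊤}`, `V = {b, c, ⊤}`, `W = {a, c, ⊤}`.  Then
* `μ` satisfies the FKG lattice condition `μ x μ y ≤ μ (x ⊓ y) μ (x ⊔ y)` (`isFKGMeasure_mu`), the lattice is modular
  (`instIsModularLattice`), and the three events are pairwise positively correlated (`cov_UV_pos` : `μ(U∩V) − μ(U)μ(V) = 11/144`);
* but Sahi's third functional is NEGATIVE: `latticeE3 μ U V W = −53/1728` (`latticeE3_diamond`), hence `¬ SahiPositive μ 3`
  (`not_sahiPositive_three_diamond`) and the "modular" variant of Sahi's Conjecture 5 at `n = 3` is false (`sahi_three_needs_distributivity`).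

Why it is filed here (the AD-route verdict, memo run/shared/lean/prim/prim-l12/prim-l12-p3/MEMO-P3-AD.md §5): the cell vector of
this configuration — masses `(m_∅, m_U, m_V, m_UV, m_W, m_UW, m_VW, m_UVW) = (1/4, 0, 0, 1/6, 0, 1/6, 1/6, 1/4)`, i.e. all mass on
`⊥`, `⊤` and the three DOUBLE-membership cells — satisfies (exact check, seat folder `lab/m3check.py`) every one of the `4 242` maximal
`0/1` event-measurable instances of the four functions theorem and of the Rinott–Saks / Aharoni–Keich six-function theorem that are
valid for three up-sets of ANY finite distributive lattice.  So the event-measurable content of the Ahlswede–Daykin family does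
not separate distributive lattices from `M₃`, where `C₃` fails: a proof of `C₃` in that family must read the instance (use
distributivity beyond membership patterns).  (The same cell vector is cut by the Gladkov–Zimin quadratic cone, value `−1/12`.)
-/

namespace Summit.CriticalPhenomena.PercolationContinuityZ3.Theorems.DiamondObstruction

open Finset
open Literature.Combinatorics.Sahi2008
open Literature.Probability.LatticeModels (mass latticeE3)

/-- The diamond lattice `M₃`: bottom, three pairwise incomparable atoms, top. [folklore] -/
inductive M3 : Type
  | bot | a | b | c | top
  deriving DecidableEq, Fintype

namespace M3

/-- Join table of `M₃`. [folklore] -/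
def sup : M3 → M3 → M3
  | bot, y => y
  | x, bot => x
  | top, _ => top
  | _, top => top
  | a, a => a
  | b, b => b
  | c, c => c
  | _, _ => top

/-- Meet table of `M₃`. [folklore] -/
def inf : M3 → M3 → M3
  | top, y => y
  | x, top => x
  | bot, _ => bot
  | _, bot => bot
  | a, a => a
  | b, b => b
  | c, c => c
  | _, _ => bot

/-- Join notation for `M₃`. [folklore] -/
instance instMax : Max M3 := ⟨sup⟩
/-- Meet notation for `M₃`. [folklore] -/
instance instMin : Min M3 := ⟨inf⟩

/-- `M₃` is a lattice (all six `Lattice.mk'` laws are finite checks). [folklore] -/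
instance instLattice : Lattice M3 :=
  Lattice.mk' (by decide) (by decide) (by decide) (by decide) (by decide) (by decide)

/-- `x ≤ y` in `M₃` iff `x ⊔ y = y` (the order of `Lattice.mk'`). [folklore] -/
theorem le_iff_sup_eq (x y : M3) : x ≤ y ↔ x ⊔ y = y := Iff.rfl

/-- The order of `M₃` is decidable (through the join table). [folklore] -/
instance decLE : DecidableRel (α := M3) (· ≤ ·) := fun x y => decidable_of_iff _ (le_iff_sup_eq x y).symm

/-- `M₃` is modular. [folklore] -/
instance instIsModularLattice : IsModularLattice M3 :=
  ⟨fun {x} y {z} h => by revert h; revert x y z; decide⟩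

/-- `M₃` is NOT distributive: `a ⊓ (b ⊔ c) = a` but `(a ⊓ b) ⊔ (a ⊓ c) = ⊥`. [folklore] -/
theorem not_distributive : ¬ ∀ x y z : M3, x ⊓ (y ⊔ z) = (x ⊓ y) ⊔ (x ⊓ z) := by decide

/-- An enumeration `M₃ ≃ Fin 5` (for explicit sums). [folklore] -/
def equivFin : M3 ≃ Fin 5 where
  toFun | bot => 0 | a => 1 | b => 2 | c => 3 | top => 4
  invFun i := match i with | ⟨0, _⟩ => bot | ⟨1, _⟩ => a | ⟨2, _⟩ => b | ⟨3, _⟩ => c | _ => top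
  left_inv x := by cases x <;> rfl
  right_inv i := by
    match i with
    | ⟨0, _⟩ => rfl | ⟨1, _⟩ => rfl | ⟨2, _⟩ => rfl | ⟨3, _⟩ => rfl | ⟨4, _⟩ => rfl
    | ⟨n + 5, h⟩ => exact absurd h (by omega)

/-- Sums over `M₃`, written out. [folklore] -/
theorem sum_eq (f : M3 → ℝ) : ∑ x, f x = f bot + f a + f b + f c + f top := by
  rw [← Equiv.sum_comp equivFin.symm f, Fin.sum_univ_five]
  rfl

end M3

open M3

/-- The weight `μ = (1/4; 1/6, 1/6, 1/6; 1/4)` on `M₃`, as integers over the common denominator `12`. [this work] -/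
def nu : M3 → ℕ
  | .bot => 3 | .a => 2 | .b => 2 | .c => 2 | .top => 3

/-- The weight `μ x = ν x / 12` as a real function. [this work] -/
noncomputable def mu : M3 → ℝ := fun x => (nu x : ℝ) / 12

/-- The FKG lattice condition for `ν` on `M₃` (finite check over `ℕ`). [this work] -/
theorem nu_fkg : ∀ x y : M3, nu x * nu y ≤ nu (x ⊓ y) * nu (x ⊔ y) := by decide

/-- `μ` is an FKG probability weight on the (modular, non-distributive) lattice `M₃`. [this work] -/
theorem isFKGMeasure_mu : IsFKGMeasure mu where
  nonneg x := by simp only [mu]; positivity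
  sum_eq_one := by rw [sum_eq]; simp only [mu, nu]; norm_num
  mul_le_mul x y := by
    have h : (nu x : ℝ) * nu y ≤ nu (x ⊓ y) * nu (x ⊔ y) := by exact_mod_cast nu_fkg x y
    simp only [mu]
    rw [div_mul_div_comm, div_mul_div_comm]
    exact div_le_div_of_nonneg_right h (by norm_num)

/-- The three up-sets `U = {a,b,⊤}`, `V = {b,c,⊤}`, `W = {a,c,⊤}` of `M₃`. [this work] -/
def U : Finset M3 := {M3.a, M3.b, M3.top}
/-- See `U`. [this work] -/
def V : Finset M3 := {M3.b, M3.c, M3.top}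
/-- See `U`. [this work] -/
def W : Finset M3 := {M3.a, M3.c, M3.top}

/-- `U, V, W` are up-sets of `M₃`. [this work] -/
theorem isUpperSet_UVW : IsUpperSet (U : Set M3) ∧ IsUpperSet (V : Set M3) ∧ IsUpperSet (W : Set M3) := by
  refine ⟨?_, ?_, ?_⟩ <;>
  · intro x y hxy hx
    simp only [U, V, W, coe_insert, coe_singleton, Set.mem_insert_iff, Set.mem_singleton_iff] at hx ⊢
    revert hxy hx; revert x y; decide

/-- The intersections of `U, V, W`. [this work] -/
theorem inters : U ∩ V = {M3.b, M3.top} ∧ U ∩ W = {M3.a, M3.top} ∧ V ∩ W = {M3.c, M3.top} ∧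
    U ∩ V ∩ W = {M3.top} := by
  refine ⟨?_, ?_, ?_, ?_⟩ <;> decide

/-- Masses: `μ(U) = μ(V) = μ(W) = 7/12`, pairwise intersections `5/12`, triple intersection `1/4`, total `1`. [this work] -/
theorem masses :
    mass mu U = 7/12 ∧ mass mu V = 7/12 ∧ mass mu W = 7/12 ∧ mass mu (U ∩ V) = 5/12 ∧ mass mu (U ∩ W) = 5/12 ∧
      mass mu (V ∩ W) = 5/12 ∧ mass mu (U ∩ V ∩ W) = 1/4 ∧ mass mu univ = 1 := by
  have huniv : mass mu univ = 1 := by unfold mass; exact isFKGMeasure_mu.sum_eq_one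
  obtain ⟨hUV, hUW, hVW, hUVW⟩ := inters
  rw [hUVW, hUV, hUW, hVW]
  simp only [mass, U, V, W]
  refine ⟨?_, ?_, ?_, ?_, ?_, ?_, ?_, huniv⟩ <;> (simp [Finset.sum_insert, mu, nu]; norm_num)

/-- The three events are pairwise positively correlated: `μ(U∩V) − μ(U)μ(V) = 11/144 > 0` (so `C₂` = Harris holds here). [this work] -/
theorem cov_UV_pos : mass mu (U ∩ V) - mass mu U * mass mu V = 11/144 := by
  obtain ⟨hU, hV, -, hUV, -⟩ := masses
  rw [hU, hV, hUV]; norm_num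

/-- **Sahi's third functional is negative on the diamond**: `latticeE3 μ U V W = −53/1728`. [this work] -/
theorem latticeE3_diamond : latticeE3 mu U V W = -53/1728 := by
  obtain ⟨hU, hV, hW, hUV, hUW, hVW, hUVW, huniv⟩ := masses
  unfold latticeE3
  rw [huniv, hUVW, hU, hV, hW, hVW, hUW, hUV]
  norm_num

/-- Hence `μ` is NOT Sahi-positive of order `3`: `E₃(1_U, 1_V, 1_W) < 0` for three nonnegative monotone functions. [this work] -/
theorem not_sahiPositive_three_diamond : ¬ SahiPositive mu 3 := by
  intro h
  obtain ⟨hU, hV, hW⟩ := isUpperSet_UVW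
  have h0 := h ![setInd U, setInd V, setInd W]
    (fun i x => by fin_cases i <;> exact setInd_nonneg _ _)
    (fun i => by fin_cases i <;> [exact monotone_setInd hU; exact monotone_setInd hV; exact monotone_setInd hW])
  rw [sahiE_three_indicator_eq_latticeE3 isFKGMeasure_mu.sum_eq_one, latticeE3_diamond] at h0
  norm_num at h0

/-- **Distributivity cannot be weakened to modularity in Sahi's Conjecture 5 (`n = 3`)**: there is a finite MODULAR lattice with an
FKG probability weight that is not Sahi-positive of order `3` (whereas `C₂` = FKG/Harris holds for the three events involved,
`cov_UV_pos`).  Cf. `Summit.…Theorems.SahiConjecture 3`, which quantifies over `DistribLattice`. [this work] -/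
theorem sahi_three_needs_distributivity :
    ∃ (α : Type) (_ : Lattice α) (_ : Fintype α) (_ : IsModularLattice α) (μ : α → ℝ),
      IsFKGMeasure μ ∧ ¬ SahiPositive μ 3 :=
  ⟨M3, inferInstance, inferInstance, inferInstance, mu, isFKGMeasure_mu, not_sahiPositive_three_diamond⟩


/-! ## Addendum: `C₂` holds for ALL pairs of events on `(M₃, μ)` — the failure is genuinely of order three -/

/-- Harris for every pair of up-sets of `M₃` under `ν` (integer form `ν(A)·ν(B) ≤ 12·ν(A ∩ B)`; finite check over the
`2¹⁰` pairs of subsets, up-set hypotheses included). [this work] -/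
theorem harris_all_upsets_nu :
    ∀ A B : Finset M3, (∀ x y : M3, x ≤ y → x ∈ A → y ∈ A) → (∀ x y : M3, x ≤ y → x ∈ B → y ∈ B) →
      (∑ x ∈ A, nu x) * (∑ x ∈ B, nu x) ≤ 12 * ∑ x ∈ A ∩ B, nu x := by
  decide

/-- Masses under `μ` are `ν`-sums over `12`. [this work] -/
theorem mass_mu_eq (A : Finset M3) : mass mu A = (∑ x ∈ A, (nu x : ℝ)) / 12 := by
  unfold mass mu
  rw [Finset.sum_div]

/-- **`(M₃, μ)` satisfies Harris / `C₂` for every pair of increasing events**: `μ(A) μ(B) ≤ μ(A ∩ B)` for all up-sets `A, B`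
(while `C₃` fails, `latticeE3_diamond`).  So on modular lattices positivity of order `2` for all events does not imply order `3`:
distributivity enters Sahi's hierarchy essentially at `n = 3`. [this work] -/
theorem harris_all_upsets {A B : Finset M3} (hA : IsUpperSet (A : Set M3)) (hB : IsUpperSet (B : Set M3)) :
    mass mu A * mass mu B ≤ mass mu (A ∩ B) := by
  have hA' : ∀ x y : M3, x ≤ y → x ∈ A → y ∈ A := fun x y hxy hx => by
    have := hA hxy (show x ∈ (A : Set M3) from hx); exact this
  have hB' : ∀ x y : M3, x ≤ y → x ∈ B → y ∈ B := fun x y hxy hx => by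
    have := hB hxy (show x ∈ (B : Set M3) from hx); exact this
  have h := harris_all_upsets_nu A B hA' hB'
  have hR : (∑ x ∈ A, (nu x : ℝ)) * (∑ x ∈ B, (nu x : ℝ)) ≤ 12 * ∑ x ∈ A ∩ B, (nu x : ℝ) := by
    exact_mod_cast h
  rw [mass_mu_eq, mass_mu_eq, mass_mu_eq, div_mul_div_comm]
  have e : (∑ x ∈ A ∩ B, (nu x : ℝ)) / 12 = (12 * ∑ x ∈ A ∩ B, (nu x : ℝ)) / (12 * 12) := by
    field_simp
  rw [e]
  exact div_le_div_of_nonneg_right hR (by norm_num)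

end Summit.CriticalPhenomena.PercolationContinuityZ3.Theorems.DiamondObstruction
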